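import Summits.AtomisticToContinuum.HydrodynamicLimit.Theorems.JParityClosureLocalSecondLawLedgerJumpA

/-!
# Entropy ledger for `JParityClosure.LocalSecondLaw` — the entropy jump at a collision, II: Hardy's bond
(stmt-AtomisticToContinuum-13081, line `exact-entropy-ledger-three-passivities`, layer 15 of stub L)

The linearised entropy jump `(N+1)⁻¹ a ∫ G (bᵢ - bⱼ)` of layer 14 is rewritten with Hardy's weak bond identity
(layer 4): `bᵢ - bⱼ` is minus the divergence of the bond `sepVec · b̄ = ε n̂ b̄` (`bondC`), and one integration
by parts against the Lipschitz weight `G = (φ/θ_r)(n̂·u_r - ⟨n̂, vᵢ⁺ + vᵢ⁻⟩/2)` gives exactly the collision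
integrands of `T₂coll` and `T₃coll` for the ordered pair `(i, j)`:
`F(t,Φₜz) - F(t,Φₜz⁻) ≤ (ε/(N+1)) [a ∫ b̄ (φ/θ) n̂n̂:∇u - ∫ (∇(φ/θ)·n̂) b̄ (a/2) ⟨vᵢ⁻+vⱼ⁻-2u, n̂⟩]`
(`a n̂·((vᵢ⁺+vᵢ⁻)/2 - u) = (a/2)⟨vᵢ⁻+vⱼ⁻-2u, n̂⟩` since `n̂·vᵢ⁺ = n̂·vⱼ⁻`).  The same bound holds for the
ordered pair `(j, i)`, whence the weight `1/2` per ordered pair, and summing over the collision times in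
`(0, τ]` bounds the total jump by `-(T₂coll + T₃coll)`.

References: R. J. Hardy, J. Chem. Phys. 76 (1982) 622, eqs. (2.8)–(2.12); J. H. Irving, J. G. Kirkwood,
J. Chem. Phys. 18 (1950) 817.
-/

noncomputable section

namespace Summit.AtomisticToContinuum.HydrodynamicLimit.Theorems.LocalSecondLawLedger

open scoped BigOperators Topology ENNReal InnerProductSpace NNReal
open Filter Set MeasureTheory Function
open Literature.MathematicalPhysics.KineticTheory
open Literature.Analysis.FluidPDE
open Literature.Analysis.FunctionSpaces
open Summit.AtomisticToContinuum.HydrodynamicLimit.Theorems.LocalSecondLawNegative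

namespace L

variable {N : ℕ}

/-- The real inner product on `ℝ³` in coordinates. [folklore] -/
theorem inner_eq_sum3 (a b : V3) : ⟪a, b⟫_ℝ = ∑ k : Fin 3, a k * b k := by
  simp only [PiLp.inner_apply, RCLike.inner_apply, conj_trivial]
  exact Finset.sum_congr rfl fun k _ => mul_comm _ _

section Contact

variable {σ : ℝ} (hσ : 0 < σ) {w : Phase N} {i j : Fin (N + 1)}
  (hct : ‖(Torus.geometry (Fin 3)).sepVec (w i).1 (w j).1‖ = hsDiameter σ N)
include hσ hct

omit hct in
/-- At contact the separation vector is `ε n̂`. [folklore] -/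
theorem sepVec_eq_smul_nrm : (Torus.geometry (Fin 3)).sepVec (w i).1 (w j).1 = hsDiameter σ N • nrm (hsDiameter σ N) w i j := by
  rw [nrm, smul_smul, mul_inv_cancel₀ (hsDiameter_pos hσ N).ne', one_smul]

/-- At contact the contact normal is a unit vector. [folklore] -/
theorem norm_nrm : ‖nrm (hsDiameter σ N) w i j‖ = 1 := by
  rw [nrm, norm_smul, hct, Real.norm_eq_abs, abs_of_pos (inv_pos.2 (hsDiameter_pos hσ N)),
    inv_mul_cancel₀ (hsDiameter_pos hσ N).ne']

end Contact

section PairBound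

variable {σ r c η₁ η₀ τ : ℝ} {F : ℝ → ℝ} (hE : EosBand η₀ F) (hη : 0 < η₁) (hη₁ : η₁ < η₀) (hσ : 0 < σ)
  (hr : 0 < r) (hc : 0 < c) {φ : ℝ → T3 → ℝ} (hφ : Torus.IsSmoothSpaceTimeOn Set.univ φ) (hφ0 : ∀ s x, 0 ≤ φ s x)
  (Φ : Flow σ N) {z : Phase N} (hR : Regular σ r τ c η₁ Φ z) {t : ℝ} (ht : t ∈ Set.Ioc 0 τ)
  {i j : Fin (N + 1)} (hij : i ≠ j)
  (hct : ‖(Torus.geometry (Fin 3)).sepVec (Φ.flow t z i).1 (Φ.flow t z j).1‖ = hsDiameter σ N)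

include hr hc hφ hR ht in
/-- The Hardy weight `G = (φ/θ)(n̂·u - C)` is Lipschitz. [folklore] -/
theorem exists_lipschitzWith_hardyWeight (n : V3) (C : ℝ) :
    ∃ K, LipschitzWith K fun x => φ t x / thetaC r (Φ.flow t z) x *
      ((∑ k, uC r (Φ.flow t z) x k * n k) - C) := by
  have hreg := hR.2 t ⟨ht.1.le, ht.2⟩
  have hφt : Torus.IsContDiff 1 (φ t) := (hφ.isSmooth_slice (Set.mem_univ t)).isContDiff (by simp)
  obtain ⟨K₁, h₁⟩ := exists_lipschitzWith_g_div_thetaC hr hc (Φ.flow t z) hreg hφt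
  have hu := fun k => exists_lipschitzWith_uC hr (Φ.flow t z) hc hreg k
  choose Ku hKu using hu
  have h₂ : LipschitzWith _ fun x => (∑ k, uC r (Φ.flow t z) x k * n k) - C :=
    (lipschitzWith_finset_sum Finset.univ fun k _ => by
      simpa only [mul_comm (uC r _ _ k)] using lipschitzWith_const_mul' (hKu k) (n k)).sub (LipschitzWith.const C)
  obtain ⟨A, hA⟩ := exists_abs_le_of_lipschitzWith h₁
  obtain ⟨B, hB⟩ := exists_abs_le_of_lipschitzWith h₂
  exact ⟨_, lipschitzWith_mul_bounded h₁ h₂ hA hB⟩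

include hc hφ hR ht in
/-- The derivative of the Hardy weight at a good field point. [folklore] -/
theorem pD_hardyWeight {x : T3}
    (hx : ∀ p, DifferentiableAt ℝ (Torus.liftAt (fun z : T3 => cone r z 0) ((Φ.flow t z p).1 - x)) 0) (n : V3) (C : ℝ)
    (k : Fin 3) :
    pD k (fun y => φ t y / thetaC r (Φ.flow t z) y * ((∑ l, uC r (Φ.flow t z) y l * n l) - C)) x =
      pD k (fun y => φ t y / thetaC r (Φ.flow t z) y) x * ((∑ l, uC r (Φ.flow t z) x l * n l) - C)
        + φ t x / thetaC r (Φ.flow t z) x * ∑ l, pD k (fun y => uC r (Φ.flow t z) y l) x * n l := by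
  have hreg := hR.2 t ⟨ht.1.le, ht.2⟩
  set e : V3 := EuclideanSpace.single k 1 with he
  have hφt : Torus.IsContDiff 1 (φ t) := (hφ.isSmooth_slice (Set.mem_univ t)).isContDiff (by simp)
  have hgl : HasDerivAt (fun s : ℝ => φ t (x + Torus.proj (s • e))) (pD k (φ t) x) 0 := hasDerivAt_smooth_line hφt x k
  have hθ := hasDerivAt_thetaC_line hc hreg hx e
  have hθ0 : thetaC r (Φ.flow t z) x ≠ 0 := (hc.trans_le (hreg x).2.2).ne'
  have hgθ : HasDerivAt (fun s : ℝ => φ t (x + Torus.proj (s • e)) / thetaC r (Φ.flow t z) (x + Torus.proj (s • e)))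
      (pD k (fun y => φ t y / thetaC r (Φ.flow t z) y) x) 0 :=
    (hgl.div hθ (by simpa using hθ0)).differentiableAt.hasDerivAt
  have hu := fun l => hasDerivAt_uC_line hc hreg hx e l
  have hW : HasDerivAt (fun s : ℝ => (∑ l, uC r (Φ.flow t z) (x + Torus.proj (s • e)) l * n l) - C)
      (∑ l, dU r (Φ.flow t z) x e l * n l) 0 := by
    simpa using (HasDerivAt.fun_sum fun l _ => (hu l).mul_const (n l)).sub_const C
  have hprod : HasDerivAt (fun s : ℝ => φ t (x + Torus.proj (s • e)) / thetaC r (Φ.flow t z) (x + Torus.proj (s • e)) *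
      ((∑ l, uC r (Φ.flow t z) (x + Torus.proj (s • e)) l * n l) - C)) _ 0 := hgθ.mul hW
  have hPu : ∀ l, pD k (fun y => uC r (Φ.flow t z) y l) x = dU r (Φ.flow t z) x e l := fun l => by
    rw [show pD k (fun y => uC r (Φ.flow t z) y l) x = deriv (fun s : ℝ => uC r (Φ.flow t z) (x + Torus.proj (s • e)) l) 0 from rfl]
    exact (hu l).deriv
  rw [show pD k (fun y => φ t y / thetaC r (Φ.flow t z) y * ((∑ l, uC r (Φ.flow t z) y l * n l) - C)) x =
    deriv (fun s : ℝ => φ t (x + Torus.proj (s • e)) / thetaC r (Φ.flow t z) (x + Torus.proj (s • e)) *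
      ((∑ l, uC r (Φ.flow t z) (x + Torus.proj (s • e)) l * n l) - C)) 0 from rfl, hprod.deriv]
  simp only [zero_smul, Torus.proj_zero, add_zero, hPu]

omit hσ in
include hr in
/-- Hardy's bond weight is continuous in the field point. [folklore] -/
theorem continuous_bondC (w : Phase N) (i j : Fin (N + 1)) : Continuous (bondC r w i j) := by
  have hc2 : Continuous (Function.uncurry fun (x : T3) (l : ℝ) =>
      cone r ((w j).1 + Torus.proj (l • (Torus.geometry (Fin 3)).sepVec (w i).1 (w j).1)) x) := by
    have : (Function.uncurry fun (x : T3) (l : ℝ) =>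
        cone r ((w j).1 + Torus.proj (l • (Torus.geometry (Fin 3)).sepVec (w i).1 (w j).1)) x) =
        fun p : T3 × ℝ => cone r ((w j).1 + Torus.proj (p.2 • (Torus.geometry (Fin 3)).sepVec (w i).1 (w j).1) - p.1) 0 := by
      funext p; exact cone_eq_sub _ _ _
    rw [this]
    exact (lipschitzWith_cone_zero hr).continuous.comp ((continuous_const.add
      (Torus.continuous_proj.comp (continuous_snd.smul continuous_const))).sub continuous_fst)
  exact continuous_parametric_integral_of_continuous hc2 isCompact_Icc

include hσ hr hc hφ hR ht in
/-- **Hardy step**: `∫ G (bᵢ - bⱼ) = ε ∫ b̄ [(∑ₖ ∂ₖ(φ/θ) n̂ₖ)(n̂·u - C) + (φ/θ) ∑ₖₗ n̂ₖn̂ₗ ∂ₖuₗ]` for the Hardy weight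
`G = (φ/θ)(n̂·u - C)`, together with the integrability of the two pieces. [folklore] -/
theorem hardy_step (C : ℝ) :
    Integrable (fun x => bondC r (Φ.flow t z) i j x *
        ((∑ k, pD k (fun y => φ t y / thetaC r (Φ.flow t z) y) x * nrm (hsDiameter σ N) (Φ.flow t z) i j k) *
          ((∑ l, uC r (Φ.flow t z) x l * nrm (hsDiameter σ N) (Φ.flow t z) i j l) - C))) ∧
    Integrable (fun x => bondC r (Φ.flow t z) i j x * (φ t x / thetaC r (Φ.flow t z) x *
        ∑ k, ∑ l, nrm (hsDiameter σ N) (Φ.flow t z) i j k * nrm (hsDiameter σ N) (Φ.flow t z) i j l *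
          pD k (fun y => uC r (Φ.flow t z) y l) x)) ∧
    ∫ x, (φ t x / thetaC r (Φ.flow t z) x *
        ((∑ k, uC r (Φ.flow t z) x k * nrm (hsDiameter σ N) (Φ.flow t z) i j k) - C)) *
        (cone r (Φ.flow t z i).1 x - cone r (Φ.flow t z j).1 x) =
      hsDiameter σ N * ((∫ x, bondC r (Φ.flow t z) i j x *
        ((∑ k, pD k (fun y => φ t y / thetaC r (Φ.flow t z) y) x * nrm (hsDiameter σ N) (Φ.flow t z) i j k) *
          ((∑ l, uC r (Φ.flow t z) x l * nrm (hsDiameter σ N) (Φ.flow t z) i j l) - C)))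
        + ∫ x, bondC r (Φ.flow t z) i j x * (φ t x / thetaC r (Φ.flow t z) x *
          ∑ k, ∑ l, nrm (hsDiameter σ N) (Φ.flow t z) i j k * nrm (hsDiameter σ N) (Φ.flow t z) i j l *
            pD k (fun y => uC r (Φ.flow t z) y l) x)) := by
  have hreg := hR.2 t ⟨ht.1.le, ht.2⟩
  have hvn := sepVec_eq_smul_nrm hσ (w := Φ.flow t z) (i := i) (j := j)
  -- Hardy's weak bond identity for the Lipschitz weight
  obtain ⟨K, hK⟩ := exists_lipschitzWith_hardyWeight hr hc hφ Φ hR ht (nrm (hsDiameter σ N) (Φ.flow t z) i j) C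
  have hxi : (Φ.flow t z i).1 = (Φ.flow t z j).1 + Torus.proj ((Torus.geometry (Fin 3)).sepVec (Φ.flow t z i).1 (Φ.flow t z j).1) := by
    have e := bond_endpoint_one (Φ.flow t z) i j
    rw [one_smul] at e
    exact e.symm
  have hH := hardy_bond hK hr (Φ.flow t z j).1 ((Torus.geometry (Fin 3)).sepVec (Φ.flow t z i).1 (Φ.flow t z j).1)
  have hbond : ∀ x, (∫ l in Set.Icc (0 : ℝ) 1, cone r ((Φ.flow t z j).1 +
      Torus.proj (l • (Torus.geometry (Fin 3)).sepVec (Φ.flow t z i).1 (Φ.flow t z j).1)) x) = bondC r (Φ.flow t z) i j x :=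
    fun x => rfl
  simp only [hbond] at hH
  rw [← hxi] at hH
  -- the derivative of the weight along the bond at good field points
  obtain ⟨Kq, hKq⟩ := exists_lipschitzWith_g_div_thetaC hr hc (Φ.flow t z) hreg
    ((hφ.isSmooth_slice (Set.mem_univ t)).isContDiff (by simp) : Torus.IsContDiff 1 (φ t))
  have huL := fun l => exists_lipschitzWith_uC hr (Φ.flow t z) hc hreg l
  choose Ku hKu using huL
  have hae : ∀ᵐ x : T3, (∑ k, (Torus.geometry (Fin 3)).sepVec (Φ.flow t z i).1 (Φ.flow t z j).1 k *
        pD k (fun y => φ t y / thetaC r (Φ.flow t z) y *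
          ((∑ l, uC r (Φ.flow t z) y l * nrm (hsDiameter σ N) (Φ.flow t z) i j l) - C)) x) * bondC r (Φ.flow t z) i j x
      = hsDiameter σ N * (bondC r (Φ.flow t z) i j x *
        ((∑ k, pD k (fun y => φ t y / thetaC r (Φ.flow t z) y) x * nrm (hsDiameter σ N) (Φ.flow t z) i j k) *
          ((∑ l, uC r (Φ.flow t z) x l * nrm (hsDiameter σ N) (Φ.flow t z) i j l) - C))
        + bondC r (Φ.flow t z) i j x * (φ t x / thetaC r (Φ.flow t z) x *
          ∑ k, ∑ l, nrm (hsDiameter σ N) (Φ.flow t z) i j k * nrm (hsDiameter σ N) (Φ.flow t z) i j l *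
            pD k (fun y => uC r (Φ.flow t z) y l) x)) := by
    filter_upwards [ae_differentiableAt_cone hr (Φ.flow t z)] with x hx
    have hpd := fun k => pD_hardyWeight hc hφ Φ hR ht hx (nrm (hsDiameter σ N) (Φ.flow t z) i j) C k
    simp only [hpd]
    simp only [hvn, PiLp.smul_apply, smul_eq_mul, Fin.sum_univ_three]
    ring
  -- integrability of the two pieces
  have hbc := continuous_bondC hr (Φ.flow t z) i j
  have hθc := continuous_thetaC hr hc (Φ.flow t z) hreg
  have huc := continuous_uC_apply hr hc (Φ.flow t z) hreg
  have hφt : Continuous (φ t) := (hφ.isSmooth_slice (Set.mem_univ t)).continuous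
  have hφθc : Continuous fun x => φ t x / thetaC r (Φ.flow t z) x := hφt.div hθc fun x => (hc.trans_le (hreg x).2.2).ne'
  have hI1 : Integrable fun x => bondC r (Φ.flow t z) i j x *
      ((∑ k, pD k (fun y => φ t y / thetaC r (Φ.flow t z) y) x * nrm (hsDiameter σ N) (Φ.flow t z) i j k) *
        ((∑ l, uC r (Φ.flow t z) x l * nrm (hsDiameter σ N) (Φ.flow t z) i j l) - C)) := by
    have e : (fun x => bondC r (Φ.flow t z) i j x *
        ((∑ k, pD k (fun y => φ t y / thetaC r (Φ.flow t z) y) x * nrm (hsDiameter σ N) (Φ.flow t z) i j k) *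
          ((∑ l, uC r (Φ.flow t z) x l * nrm (hsDiameter σ N) (Φ.flow t z) i j l) - C))) =
        fun x => ∑ k, (bondC r (Φ.flow t z) i j x * ((∑ l, uC r (Φ.flow t z) x l * nrm (hsDiameter σ N) (Φ.flow t z) i j l) - C)
          * nrm (hsDiameter σ N) (Φ.flow t z) i j k) * pD k (fun y => φ t y / thetaC r (Φ.flow t z) y) x := by
      funext x; rw [Finset.sum_mul, Finset.mul_sum]; exact Finset.sum_congr rfl fun k _ => by ring
    rw [e]
    refine integrable_finsetSum _ fun k _ => ?_
    exact integrable_continuous_mul ((hbc.mul ((continuous_finsetSum _ fun l _ => (huc l).mul continuous_const).sub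
      continuous_const)).mul continuous_const) (measurable_pD k hφθc) (abs_pD_le hKq k)
  have hI2 : Integrable fun x => bondC r (Φ.flow t z) i j x * (φ t x / thetaC r (Φ.flow t z) x *
      ∑ k, ∑ l, nrm (hsDiameter σ N) (Φ.flow t z) i j k * nrm (hsDiameter σ N) (Φ.flow t z) i j l *
        pD k (fun y => uC r (Φ.flow t z) y l) x) := by
    have e : (fun x => bondC r (Φ.flow t z) i j x * (φ t x / thetaC r (Φ.flow t z) x *
        ∑ k, ∑ l, nrm (hsDiameter σ N) (Φ.flow t z) i j k * nrm (hsDiameter σ N) (Φ.flow t z) i j l *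
          pD k (fun y => uC r (Φ.flow t z) y l) x)) =
        fun x => ∑ k, ∑ l, (bondC r (Φ.flow t z) i j x * (φ t x / thetaC r (Φ.flow t z) x) *
          (nrm (hsDiameter σ N) (Φ.flow t z) i j k * nrm (hsDiameter σ N) (Φ.flow t z) i j l)) *
            pD k (fun y => uC r (Φ.flow t z) y l) x := by
      funext x; rw [Finset.mul_sum, Finset.mul_sum]; refine Finset.sum_congr rfl fun k _ => ?_
      rw [Finset.mul_sum, Finset.mul_sum]; exact Finset.sum_congr rfl fun l _ => by ring
    rw [e]
    refine integrable_finsetSum _ fun k _ => integrable_finsetSum _ fun l _ => ?_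
    exact integrable_continuous_mul ((hbc.mul hφθc).mul continuous_const) (measurable_pD k (huc l)) (abs_pD_le (hKu l) k)
  refine ⟨hI1, hI2, ?_⟩
  rw [hH, integral_congr_ae hae, integral_const_mul, integral_add hI1 hI2]

include hσ hR hij hct in
/-- **The kinematic identity** `a (n̂·u - ⟨n̂, vᵢ⁺ + vᵢ⁻⟩/2) = -(a/2) ⟨vᵢ⁻ + vⱼ⁻ - 2u, n̂⟩` (`n̂·vᵢ⁺ = n̂·vⱼ⁻`).
[folklore] -/
theorem impulse_kinematic (u : V3) :
    impulse (hsDiameter σ N) (Φ.flow t z) i j *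
        ((∑ l, u l * nrm (hsDiameter σ N) (Φ.flow t z) i j l)
          - ⟪nrm (hsDiameter σ N) (Φ.flow t z) i j, (Φ.flow t z i).2 + (leftLim (fun s => Φ.flow s z) t i).2⟫_ℝ / 2) =
      -(impulse (hsDiameter σ N) (Φ.flow t z) i j / 2 *
        ⟪(vin (Φ.flow t z) i j).1 + (vin (Φ.flow t z) i j).2 - (2 : ℝ) • u, nrm (hsDiameter σ N) (Φ.flow t z) i j⟫_ℝ) := by
  have hn1 := norm_nrm hσ hct
  have hvin := vin_flow_eq_leftLim Φ hR.1 hij hct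
  have hai := impulse_flow_eq_inner Φ hR.1 hij hct
  have hΔ := vel_sub_leftLim_eq_impulse_smul_nrm' Φ hR.1 hij hct
  have hnn : nrm (hsDiameter σ N) (Φ.flow t z) i j 0 * nrm (hsDiameter σ N) (Φ.flow t z) i j 0
      + nrm (hsDiameter σ N) (Φ.flow t z) i j 1 * nrm (hsDiameter σ N) (Φ.flow t z) i j 1
      + nrm (hsDiameter σ N) (Φ.flow t z) i j 2 * nrm (hsDiameter σ N) (Φ.flow t z) i j 2 = 1 := by
    have h : ⟪nrm (hsDiameter σ N) (Φ.flow t z) i j, nrm (hsDiameter σ N) (Φ.flow t z) i j⟫_ℝ = 1 := by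
      rw [real_inner_self_eq_norm_sq, hn1, one_pow]
    rw [inner_eq_sum3, Fin.sum_univ_three] at h
    exact h
  have hvi' : (Φ.flow t z i).2 = (leftLim (fun s => Φ.flow s z) t i).2
      + impulse (hsDiameter σ N) (Φ.flow t z) i j • nrm (hsDiameter σ N) (Φ.flow t z) i j := by
    rw [← hΔ]; abel
  have hai' := hai
  rw [inner_eq_sum3, Fin.sum_univ_three] at hai'
  simp only [PiLp.sub_apply] at hai'
  rw [hvin, hvi']
  simp only [inner_eq_sum3, Fin.sum_univ_three, PiLp.add_apply, PiLp.sub_apply, PiLp.smul_apply, smul_eq_mul]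
  linear_combination (-(impulse (hsDiameter σ N) (Φ.flow t z) i j / 2)) * hai'
    + (-(impulse (hsDiameter σ N) (Φ.flow t z) i j ^ 2 / 2)) * hnn

include hE hη₁ hσ hr hc hφ hφ0 hR ht hij hct in
/-- **The entropy jump is bounded by the collision integrands of the ordered pair `(i, j)`.** [folklore] -/
theorem collisionJump_obs_le_pair :
    collisionJump (obs σ c η₀ η₁ r φ t) (fun s => Φ.flow s z) t ≤
      hsDiameter σ N / (N + 1 : ℝ) *
        ((∫ x, φ t x / thetaC r (Φ.flow t z) x * bondC r (Φ.flow t z) i j x * impulse (hsDiameter σ N) (Φ.flow t z) i j *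
            ∑ k, ∑ l, nrm (hsDiameter σ N) (Φ.flow t z) i j k * nrm (hsDiameter σ N) (Φ.flow t z) i j l *
              pD k (fun y => uC r (Φ.flow t z) y l) x)
          - ∫ x, (∑ k, pD k (fun y => φ t y / thetaC r (Φ.flow t z) y) x * nrm (hsDiameter σ N) (Φ.flow t z) i j k) *
              bondC r (Φ.flow t z) i j x * (impulse (hsDiameter σ N) (Φ.flow t z) i j / 2) *
              ⟪(vin (Φ.flow t z) i j).1 + (vin (Φ.flow t z) i j).2 - (2 : ℝ) • uC r (Φ.flow t z) x,
                nrm (hsDiameter σ N) (Φ.flow t z) i j⟫_ℝ) := by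
  have h1 := collisionJump_obs_le hE hη₁ hσ hr hc hφ hφ0 Φ hR ht hij hct
  obtain ⟨hI1, hI2, hH⟩ := hardy_step hσ hr hc hφ Φ hR ht (i := i) (j := j)
    (⟪nrm (hsDiameter σ N) (Φ.flow t z) i j, (Φ.flow t z i).2 + (leftLim (fun s => Φ.flow s z) t i).2⟫_ℝ / 2)
  have hkin := fun x => impulse_kinematic hσ Φ hR hij hct (uC r (Φ.flow t z) x)
  refine h1.trans (le_of_eq ?_)
  rw [hH]
  -- rewrite the two target integrals through the pieces of the Hardy step
  have e2 : (∫ x, φ t x / thetaC r (Φ.flow t z) x * bondC r (Φ.flow t z) i j x * impulse (hsDiameter σ N) (Φ.flow t z) i j *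
        ∑ k, ∑ l, nrm (hsDiameter σ N) (Φ.flow t z) i j k * nrm (hsDiameter σ N) (Φ.flow t z) i j l *
          pD k (fun y => uC r (Φ.flow t z) y l) x) =
      impulse (hsDiameter σ N) (Φ.flow t z) i j * ∫ x, bondC r (Φ.flow t z) i j x * (φ t x / thetaC r (Φ.flow t z) x *
        ∑ k, ∑ l, nrm (hsDiameter σ N) (Φ.flow t z) i j k * nrm (hsDiameter σ N) (Φ.flow t z) i j l *
          pD k (fun y => uC r (Φ.flow t z) y l) x) := by
    rw [← integral_const_mul]
    exact integral_congr_ae (Filter.Eventually.of_forall fun x => by ring)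
  have e3 : (∫ x, (∑ k, pD k (fun y => φ t y / thetaC r (Φ.flow t z) y) x * nrm (hsDiameter σ N) (Φ.flow t z) i j k) *
        bondC r (Φ.flow t z) i j x * (impulse (hsDiameter σ N) (Φ.flow t z) i j / 2) *
        ⟪(vin (Φ.flow t z) i j).1 + (vin (Φ.flow t z) i j).2 - (2 : ℝ) • uC r (Φ.flow t z) x,
          nrm (hsDiameter σ N) (Φ.flow t z) i j⟫_ℝ) =
      -impulse (hsDiameter σ N) (Φ.flow t z) i j * ∫ x, bondC r (Φ.flow t z) i j x *
        ((∑ k, pD k (fun y => φ t y / thetaC r (Φ.flow t z) y) x * nrm (hsDiameter σ N) (Φ.flow t z) i j k) *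
          ((∑ l, uC r (Φ.flow t z) x l * nrm (hsDiameter σ N) (Φ.flow t z) i j l)
            - ⟪nrm (hsDiameter σ N) (Φ.flow t z) i j, (Φ.flow t z i).2 + (leftLim (fun s => Φ.flow s z) t i).2⟫_ℝ / 2)) := by
    rw [← integral_const_mul]
    refine integral_congr_ae (Filter.Eventually.of_forall fun x => ?_)
    have hk := hkin x
    calc (∑ k, pD k (fun y => φ t y / thetaC r (Φ.flow t z) y) x * nrm (hsDiameter σ N) (Φ.flow t z) i j k) *
          bondC r (Φ.flow t z) i j x * (impulse (hsDiameter σ N) (Φ.flow t z) i j / 2) *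
          ⟪(vin (Φ.flow t z) i j).1 + (vin (Φ.flow t z) i j).2 - (2 : ℝ) • uC r (Φ.flow t z) x,
            nrm (hsDiameter σ N) (Φ.flow t z) i j⟫_ℝ
        = (∑ k, pD k (fun y => φ t y / thetaC r (Φ.flow t z) y) x * nrm (hsDiameter σ N) (Φ.flow t z) i j k) *
            bondC r (Φ.flow t z) i j x * (impulse (hsDiameter σ N) (Φ.flow t z) i j / 2 *
            ⟪(vin (Φ.flow t z) i j).1 + (vin (Φ.flow t z) i j).2 - (2 : ℝ) • uC r (Φ.flow t z) x,
              nrm (hsDiameter σ N) (Φ.flow t z) i j⟫_ℝ) := by ring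
      _ = _ := by rw [show impulse (hsDiameter σ N) (Φ.flow t z) i j / 2 *
            ⟪(vin (Φ.flow t z) i j).1 + (vin (Φ.flow t z) i j).2 - (2 : ℝ) • uC r (Φ.flow t z) x,
              nrm (hsDiameter σ N) (Φ.flow t z) i j⟫_ℝ = -(impulse (hsDiameter σ N) (Φ.flow t z) i j *
            ((∑ l, uC r (Φ.flow t z) x l * nrm (hsDiameter σ N) (Φ.flow t z) i j l)
              - ⟪nrm (hsDiameter σ N) (Φ.flow t z) i j, (Φ.flow t z i).2 + (leftLim (fun s => Φ.flow s z) t i).2⟫_ℝ / 2))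
            by linarith [hk]]; ring
  rw [e2, e3]
  push_cast
  ring

end PairBound

end L

/-- **Registered sub-goal `ledgerL_jumpB`** of stub `stub_ledger` (line `exact-entropy-ledger-three-passivities`):
The kinematic identity of the collision kinematics behind the heat-current collision integrand. [folklore] -/
theorem ledgerL_jumpB :
  ∀ {N : ℕ} {σ r τ c η₁ : ℝ}, 0 < σ → ∀ (Φ : Flow σ N) {z : Phase N}, Regular σ r τ c η₁ Φ z → ∀ {t : ℝ} {i j : Fin (N + 1)}, i ≠ j → ‖(Torus.geometry (Fin 3)).sepVec (Φ.flow t z i).1 (Φ.flow t z j).1‖ = hsDiameter σ N → ∀ u : V3, impulse (hsDiameter σ N) (Φ.flow t z) i j * ((∑ l, u l * nrm (hsDiameter σ N) (Φ.flow t z) i j l) - ⟪nrm (hsDiameter σ N) (Φ.flow t z) i j, (Φ.flow t z i).2 + (Function.leftLim (fun s => Φ.flow s z) t i).2⟫_ℝ / 2) = -(impulse (hsDiameter σ N) (Φ.flow t z) i j / 2 * ⟪(vin (Φ.flow t z) i j).1 + (vin (Φ.flow t z) i j).2 - (2 : ℝ) • u, nrm (hsDiameter σ N) (Φ.flow t z)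 i j⟫_ℝ) := by
  intro N σ r τ c η₁ hσ Φ z hR t i j hij hct u
  exact L.impulse_kinematic hσ Φ hR hij hct u

end Summit.AtomisticToContinuum.HydrodynamicLimit.Theorems.LocalSecondLawLedger

end
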